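import Summits.MatrixMultiplication.MatrixMultiplication.Theorems.SaturationLadderCornerModulus
import Summits.MatrixMultiplication.MatrixMultiplication.Theorems.SaturationLadderFaceModulus
import HarnessLib

/-!
# Route `SaturationLadder` on Strassen's spectrum, V: the POWER MODULUS — `PolySaturation` is the
# geometric-mean law `d ≤ B·θ₁^{1−α}·ε₂^α`

decomp-mm lens 1 «grading / quantitative ladder», gen 44, kernel K44-P (chain file 5; files 1–4 =
`SaturationLadderThinRoof`, `SaturationLadderCornerGerm`, `SaturationLadderCornerModulus`, `SaturationLadderFaceModulus`).
Def-free, sorry-free support beneath the deciding crux `SubexpSaturation` (stmt-MatrixMultiplication-25909) of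
`route-MatrixMultiplication-SaturationLadder`; cut of record UNCHANGED
(`closes (h₁ : SubexpSaturation) (h₂ : SubexpToPoly) (h₃ : PolyToFinite) (h₄ : TailDescentTwo) (h₅ : SquareFromTwo)`).

Notation: universal spectral point `φ`, `θ = specMMPoint K φ ∈ [0,1]³`, DARKNESS `d = θ₀+θ₁+θ₂−2`, HEIGHT `θ₁`,
DEPTH `ε₂ = 1−θ₂`.  Files 3 and 4 typed two moduli of `d` at the light face: the CORNER (logarithmic) modulus
`d·log(θ₁/ε₂) ≤ κθ₁` (`h₁ ⟺` it holds for every `κ > 0`) and the FACE (Hölder) modulus `d ≤ Bε₂^α` (= power rate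
`e(k) ≤ Ck^{−α/(1−α)}`; exponent `log 2/log 11` PROVED).  This file types the rung BETWEEN them:

* §1 ★★★ `polyRoof`/`powerModulus` exchange (every field) and **`polySaturation_iff_powerModulus`** (over `ℂ`):
  `PolySaturation ⟺ ∃ α ∈ (0,1) ∃ B ∀φ: d ≤ B·θ₁^{1−α}·ε₂^α` — the polynomial tight length
  `r(t) ≤ C(1−t)^{−k}` is the GEOMETRIC-MEAN (power) modulus of darkness in height and depth, `α = 1/(k+1)`
  (optimum of `d ≤ sθ₁ + C s^{−k}ε₂` at `s = M/θ₁`, `M^{k+1} = Cε₂θ₁^k`; backwards `k = ⌈(1−α)/α⌉`,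
  `C = B·B^{(1−α)/α} + 1` by the case split `Bθ₁^{1−α}ε₂^α ≤ sθ₁` or `θ₁ < (B/s)^{1/α}ε₂`).
* §2 ★★ the power modulus sits between the two moduli of files 3–4, QUANTITATIVELY: it implies the Hölder face law
  with the SAME exponent (`holderFace_of_powerModulus`, `θ₁^{1−α} ≤ 1`) and the corner modulus law at EVERY
  `κ > 0` with explicit threshold `u₀ = 2B/(α²κ)` (`logModulus_of_powerModulus`: `ε₂ = θ₁e^{−u}` turns the law into
  `d ≤ Bθ₁e^{−αu}`, and `u e^{−αu} ≤ 2/(α²u)`); hence `PolySaturation ⟹ SubexpSaturation` and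
  `PolySaturation ⟹` power rate `α/(1−α) = 1/k`, read off the moduli (`subexpSaturation_of_powerModulus`,
  `farRate_of_powerModulus`).

So the LADDER OF MODULI reads (top = summit): corner-log `κ* ≤ c₂ = 1.0650…` [PROVED, file 3] → `κ* = 0` [`h₁`]
→ power `∃α` [`PolySaturation`; `h₂`] → Lipschitz face `∃k` [`FiniteSaturation`; `h₃`] → slope `1` [`E₂`; `h₄`] →
`d ≡ 0` [`ω = 2`; `h₅`] (file 6 names the lifts).  Nothing here proves `ω = 2` or an open item; no definitions (gate
rule D-0009).  [cite: Strassen1988, Thm. 3.8] [cite: LottiRomani1983, Prop. 4.1; Thm. 2] [cite: HuangPan1998, (2.8)]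
[cite: AlmanLi2026, Proposition 4.2] [cite: AlmanDuanVassilevskaWilliamsXuXuZhou2025, §3.4]
-/

set_option linter.dupNamespace false

noncomputable section

open scoped BigOperators

namespace Summit.MatrixMultiplication.MatrixMultiplication.Theorems.SaturationLadderPowerModulus

open Literature.Computability.AlgebraicComplexity
open Summit.MatrixMultiplication.MatrixMultiplication.Theses.SaturationLadder
open Summit.MatrixMultiplication.MatrixMultiplication.Theorems.SaturationLadderThinRoof
open Summit.MatrixMultiplication.MatrixMultiplication.Theorems.SaturationLadderCornerGerm
open Summit.MatrixMultiplication.MatrixMultiplication.Theorems.SaturationLadderCornerModulus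
open Summit.MatrixMultiplication.MatrixMultiplication.Theorems.SaturationLadderFaceModulus

variable {K : Type} [Field K]

/-! ## §1 Polynomial tight length ⟺ the power modulus -/

/-- ★★ **Polynomial roof ⟹ power modulus** (every field): if `t·θ₁ ≤ (1−θ₀) + C·(1−t)^{−k}·(1−θ₂)` at every universal
spectral point for all `t ∈ [0,1)` (`C > 0`, `k` a natural number), then every universal spectral point obeys
`θ₀+θ₁+θ₂−2 ≤ 2·C^{1/(k+1)}·θ₁^{k/(k+1)}·(1−θ₂)^{1/(k+1)}`.  (`M^{k+1} = C(1−θ₂)θ₁^k`; if `θ₁ > C(1−θ₂)` take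
`1−t = M/θ₁ < 1`: `d ≤ 2M − (1−θ₂)`; else `d ≤ θ₁ ≤ M`; on the face `d ≤ 0` by `face_light`.)
[cite: Strassen1988, Thm. 3.8] [cite: LottiRomani1983, Thm. 2] -/
theorem powerModulus_of_polyRoof {C : ℝ} {k : ℕ} (hC : 0 < C)
    (h : ∀ t : ℝ, 0 ≤ t → t < 1 → ∀ F : SpectralMap K, IsUniversalSpectralPoint K F →
      t * specMMPoint K F 1 ≤ (1 - specMMPoint K F 0) + C * ((1 - t)⁻¹) ^ k * (1 - specMMPoint K F 2))
    {F : SpectralMap K} (hF : IsUniversalSpectralPoint K F) :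
    specMMPoint K F 0 + specMMPoint K F 1 + specMMPoint K F 2 - 2 ≤
      2 * C ^ (1 / ((k : ℝ) + 1)) * specMMPoint K F 1 ^ ((k : ℝ) / ((k : ℝ) + 1)) *
        (1 - specMMPoint K F 2) ^ (1 / ((k : ℝ) + 1)) := by
  set θ₀ := specMMPoint K F 0 with hθ₀
  set θ₁ := specMMPoint K F 1 with hθ₁
  set θ₂ := specMMPoint K F 2 with hθ₂
  have h0 := AlmanLi2026.prop42_mem_Icc hF 0
  have h1 := AlmanLi2026.prop42_mem_Icc hF 1
  have h2 := AlmanLi2026.prop42_mem_Icc hF 2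
  rw [← hθ₀] at h0
  rw [← hθ₁] at h1
  rw [← hθ₂] at h2
  have hε : 0 ≤ 1 - θ₂ := by linarith [h2.2]
  have hk1 : (0 : ℝ) < (k : ℝ) + 1 := by positivity
  set a : ℝ := 1 / ((k : ℝ) + 1) with ha
  have ha0 : 0 < a := by positivity
  have ha' : a = ((k + 1 : ℕ) : ℝ)⁻¹ := by rw [ha, one_div]; push_cast; rfl
  -- the common value `M`, `M^{k+1} = C ε₂ θ₁^k`
  set M : ℝ := (C * (1 - θ₂) * θ₁ ^ k) ^ a with hMdef
  have hX : 0 ≤ C * (1 - θ₂) * θ₁ ^ k := mul_nonneg (mul_nonneg hC.le hε) (pow_nonneg h1.1 k)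
  have hM0 : 0 ≤ M := Real.rpow_nonneg hX a
  have hMpow : M ^ (k + 1) = C * (1 - θ₂) * θ₁ ^ k := by
    rw [hMdef, ha', Real.rpow_inv_natCast_pow hX (by omega)]
  have hgoal : 2 * C ^ (1 / ((k : ℝ) + 1)) * θ₁ ^ ((k : ℝ) / ((k : ℝ) + 1)) * (1 - θ₂) ^ (1 / ((k : ℝ) + 1)) =
      2 * M := by
    rw [hMdef, Real.mul_rpow (mul_nonneg hC.le hε) (pow_nonneg h1.1 k), Real.mul_rpow hC.le hε,
      ← Real.rpow_natCast θ₁ k, ← Real.rpow_mul h1.1, ← ha]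
    have : (k : ℝ) * a = (k : ℝ) / ((k : ℝ) + 1) := by rw [ha]; field_simp
    rw [this]
    ring
  rw [hgoal]
  rcases hε.eq_or_lt with hε0 | hε0
  · -- on the face: `d ≤ 0 ≤ 2M`
    have hface := face_light hF (show specMMPoint K F 2 = 1 by rw [← hθ₂]; linarith)
    rw [← hθ₀, ← hθ₁] at hface
    linarith
  by_cases hlow : θ₁ ≤ C * (1 - θ₂)
  · -- low point: `θ₁ ≤ M`
    have hθM : θ₁ ≤ M := by
      refine le_of_pow_le_pow_left₀ (by omega : k + 1 ≠ 0) hM0 ?_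
      rw [hMpow, pow_succ]
      calc θ₁ ^ k * θ₁ ≤ θ₁ ^ k * (C * (1 - θ₂)) := mul_le_mul_of_nonneg_left hlow (pow_nonneg h1.1 k)
        _ = C * (1 - θ₂) * θ₁ ^ k := by ring
    linarith [h0.2, h2.2]
  · -- high point: `1 - t = M/θ₁ ∈ (0,1)`
    push Not at hlow
    have hθ1 : 0 < θ₁ := lt_of_le_of_lt (mul_pos hC hε0).le hlow
    have hXpos : 0 < C * (1 - θ₂) * θ₁ ^ k := mul_pos (mul_pos hC hε0) (pow_pos hθ1 k)
    have hMpos : 0 < M := Real.rpow_pos_of_pos hXpos a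
    have hMθ : M < θ₁ := by
      refine lt_of_pow_lt_pow_left₀ (k + 1) h1.1 ?_
      rw [hMpow, pow_succ]
      calc C * (1 - θ₂) * θ₁ ^ k = θ₁ ^ k * (C * (1 - θ₂)) := by ring
        _ < θ₁ ^ k * θ₁ := mul_lt_mul_of_pos_left hlow (pow_pos hθ1 k)
    set s : ℝ := M / θ₁ with hs
    have hs0 : 0 < s := div_pos hMpos hθ1
    have hs1 : s < 1 := (div_lt_one hθ1).2 hMθ
    have hsθ : s * θ₁ = M := div_mul_cancel₀ _ hθ1.ne'
    have hroof := h (1 - s) (by linarith) (by linarith) F hF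
    rw [← hθ₀, ← hθ₁, ← hθ₂, sub_sub_cancel] at hroof
    -- `C (s⁻¹)^k ε₂ = M`
    have hval : C * s⁻¹ ^ k * (1 - θ₂) = M := by
      have hMk : 0 < M ^ k := pow_pos hMpos k
      rw [hs, inv_div, div_pow]
      have : C * (θ₁ ^ k / M ^ k) * (1 - θ₂) = (C * (1 - θ₂) * θ₁ ^ k) / M ^ k := by ring
      rw [this, div_eq_iff hMk.ne', ← hMpow]
      ring
    rw [hval] at hroof
    nlinarith [hroof, hsθ, hε0]

set_option maxHeartbeats 400000 in
/-- ★★ **Power modulus ⟹ polynomial roof** (every field): if every universal spectral point obeys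
`θ₀+θ₁+θ₂−2 ≤ B·θ₁^{1−α}·(1−θ₂)^α` (`B > 0`, `0 < α < 1`), then with `k = ⌈(1−α)/α⌉` and
`C = B·B^{(1−α)/α} + 1`, for all `t ∈ [0,1)`: `t·θ₁ ≤ (1−θ₀) + C·(1−t)^{−k}·(1−θ₂)` at every universal spectral point
(either the Hölder bound is below `(1−t)θ₁`, or `θ₁ < (B/(1−t))^{1/α}(1−θ₂)` and the bound is below
`B·B^{(1−α)/α}(1−t)^{−(1−α)/α}(1−θ₂)`). [cite: Strassen1988, Thm. 3.8] [cite: LottiRomani1983, Thm. 2] -/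
theorem polyRoof_of_powerModulus {B α : ℝ} (hB : 0 < B) (hα : 0 < α) (hα1 : α < 1)
    (h : ∀ F : SpectralMap K, IsUniversalSpectralPoint K F →
      specMMPoint K F 0 + specMMPoint K F 1 + specMMPoint K F 2 - 2 ≤
        B * specMMPoint K F 1 ^ (1 - α) * (1 - specMMPoint K F 2) ^ α)
    {t : ℝ} (ht0 : 0 ≤ t) (ht1 : t < 1) {F : SpectralMap K} (hF : IsUniversalSpectralPoint K F) :
    t * specMMPoint K F 1 ≤ (1 - specMMPoint K F 0) +
      (B * B ^ ((1 - α) / α) + 1) * ((1 - t)⁻¹) ^ ⌈(1 - α) / α⌉₊ * (1 - specMMPoint K F 2) := by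
  set θ₀ := specMMPoint K F 0 with hθ₀
  set θ₁ := specMMPoint K F 1 with hθ₁
  set θ₂ := specMMPoint K F 2 with hθ₂
  set k : ℕ := ⌈(1 - α) / α⌉₊ with hk
  set γ : ℝ := (1 - α) / α with hγ
  have h0 := AlmanLi2026.prop42_mem_Icc hF 0
  have h1 := AlmanLi2026.prop42_mem_Icc hF 1
  have h2 := AlmanLi2026.prop42_mem_Icc hF 2
  rw [← hθ₀] at h0
  rw [← hθ₁] at h1
  rw [← hθ₂] at h2
  have hd := h F hF
  rw [← hθ₀, ← hθ₁, ← hθ₂] at hd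
  have hε : 0 ≤ 1 - θ₂ := by linarith [h2.2]
  have h1α : 0 < 1 - α := by linarith
  have hγ0 : 0 < γ := by positivity
  set s : ℝ := 1 - t with hs
  have hs0 : 0 < s := by rw [hs]; linarith
  have hs1 : s ≤ 1 := by rw [hs]; linarith
  have hsi : 1 ≤ s⁻¹ := (one_le_inv₀ hs0).2 hs1
  have hsk : (1 : ℝ) ≤ s⁻¹ ^ k := one_le_pow₀ hsi
  have hBγ : 0 < B ^ γ := Real.rpow_pos_of_pos hB γ
  have hεk : (1 - θ₂) ≤ s⁻¹ ^ k * (1 - θ₂) := le_mul_of_one_le_left hε hsk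
  by_cases hcase : B * θ₁ ^ (1 - α) * (1 - θ₂) ^ α ≤ s * θ₁
  · -- the linear term absorbs the bound: `tθ₁ ≤ ε₀ + ε₂`
    have : t * θ₁ = θ₁ - s * θ₁ := by rw [hs]; ring
    have hnn : 0 ≤ B * B ^ γ * (s⁻¹ ^ k * (1 - θ₂)) := by positivity
    have hsθ : 0 ≤ s * θ₁ := mul_nonneg hs0.le h1.1
    nlinarith [hεk, hnn, hd, hcase, this, hsθ]
  · push Not at hcase
    -- `θ₁ > 0` and `ε₂ > 0`
    have hθ1 : 0 < θ₁ := by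
      rcases h1.1.eq_or_lt with h10 | h10
      · exfalso
        rw [← h10, Real.zero_rpow h1α.ne'] at hcase
        simp at hcase
      · exact h10
    have hε0 : 0 < 1 - θ₂ := by
      rcases hε.eq_or_lt with he | he
      · exfalso
        rw [← he, Real.zero_rpow hα.ne', mul_zero] at hcase
        linarith [mul_pos hs0 hθ1]
      · exact he
    -- divide by `θ₁^{1-α}`: `s θ₁^α < B ε₂^α`
    have hθ1a : 0 < θ₁ ^ (1 - α) := Real.rpow_pos_of_pos hθ1 _
    have hsplit : θ₁ = θ₁ ^ (1 - α) * θ₁ ^ α := by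
      rw [← Real.rpow_add hθ1, sub_add_cancel, Real.rpow_one]
    have hlt1 : s * θ₁ ^ α < B * (1 - θ₂) ^ α := by
      have : θ₁ ^ (1 - α) * (s * θ₁ ^ α) < θ₁ ^ (1 - α) * (B * (1 - θ₂) ^ α) := by
        calc θ₁ ^ (1 - α) * (s * θ₁ ^ α) = s * (θ₁ ^ (1 - α) * θ₁ ^ α) := by ring
          _ = s * θ₁ := by rw [← hsplit]
          _ < B * θ₁ ^ (1 - α) * (1 - θ₂) ^ α := hcase
          _ = θ₁ ^ (1 - α) * (B * (1 - θ₂) ^ α) := by ring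
      exact lt_of_mul_lt_mul_left this hθ1a.le
    -- raise to `1/α`: `θ₁ < (B/s)^{1/α} ε₂`
    have hlt2 : θ₁ ^ α < B / s * (1 - θ₂) ^ α := by
      rw [div_mul_eq_mul_div, lt_div_iff₀ hs0]
      linarith
    have hlt3 : θ₁ < (B / s) ^ (1 / α) * (1 - θ₂) := by
      have := Real.rpow_lt_rpow (Real.rpow_nonneg h1.1 _) hlt2 (by positivity : (0 : ℝ) < 1 / α)
      rwa [← Real.rpow_mul h1.1, mul_one_div_cancel hα.ne', Real.rpow_one,
        Real.mul_rpow (by positivity) (Real.rpow_nonneg hε _), ← Real.rpow_mul hε,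
        mul_one_div_cancel hα.ne', Real.rpow_one] at this
    -- hence `θ₁^{1-α} ≤ (B/s)^γ ε₂^{1-α}` and the bound is `≤ B B^γ (s⁻¹)^γ ε₂ ≤ B B^γ (s⁻¹)^k ε₂`
    have hle4 : θ₁ ^ (1 - α) ≤ (B / s) ^ γ * (1 - θ₂) ^ (1 - α) := by
      have := Real.rpow_le_rpow h1.1 hlt3.le h1α.le
      rwa [Real.mul_rpow (Real.rpow_nonneg (by positivity) _) hε, ← Real.rpow_mul (by positivity),
        show 1 / α * (1 - α) = γ by rw [hγ]; field_simp] at this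
    have hBs : (B / s) ^ γ = B ^ γ * s⁻¹ ^ γ := by
      rw [div_eq_mul_inv, Real.mul_rpow hB.le (by positivity)]
    have hsγk : s⁻¹ ^ γ ≤ s⁻¹ ^ k := by
      rw [← Real.rpow_natCast]
      exact Real.rpow_le_rpow_of_exponent_le hsi (Nat.le_ceil _)
    have hεα : 0 < (1 - θ₂) ^ α := Real.rpow_pos_of_pos hε0 α
    have hεsplit : (1 - θ₂) ^ (1 - α) * (1 - θ₂) ^ α = 1 - θ₂ := by
      rw [← Real.rpow_add hε0, sub_add_cancel, Real.rpow_one]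
    have heq : B * ((B / s) ^ γ * (1 - θ₂) ^ (1 - α)) * (1 - θ₂) ^ α = B * B ^ γ * s⁻¹ ^ γ * (1 - θ₂) := by
      rw [hBs]
      conv_rhs => rw [← hεsplit]
      ring
    have hbound : B * θ₁ ^ (1 - α) * (1 - θ₂) ^ α ≤ B * B ^ γ * s⁻¹ ^ k * (1 - θ₂) := by
      calc B * θ₁ ^ (1 - α) * (1 - θ₂) ^ α
          ≤ B * ((B / s) ^ γ * (1 - θ₂) ^ (1 - α)) * (1 - θ₂) ^ α := by
            have := mul_le_mul_of_nonneg_left hle4 hB.le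
            exact mul_le_mul_of_nonneg_right this hεα.le
        _ = B * B ^ γ * s⁻¹ ^ γ * (1 - θ₂) := heq
        _ ≤ B * B ^ γ * s⁻¹ ^ k * (1 - θ₂) := by
            have := mul_le_mul_of_nonneg_left hsγk (by positivity : (0 : ℝ) ≤ B * B ^ γ * (1 - θ₂))
            nlinarith
    have : t * θ₁ = θ₁ - s * θ₁ := by rw [hs]; ring
    have hsθ : 0 ≤ s * θ₁ := by positivity
    nlinarith [hεk, hbound]

/-- ★★★ **`PolySaturation` IS THE POWER MODULUS** (over `ℂ`): the information-tight length of the thin shapes is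
polynomial, `r(t) ≤ C·(1−t)^{−k}` on `[0,1)`, if and only if the darkness of the complex matrix-multiplication
spectrum obeys a geometric-mean law in height and depth, `∃ α ∈ (0,1) ∃ B > 0 ∀φ: θ₀+θ₁+θ₂−2 ≤ B·θ₁^{1−α}·(1−θ₂)^α`
(`α = 1/(k+2)` forwards after raising `k` by one; `k = ⌈(1−α)/α⌉` backwards).
[cite: Strassen1988, Thm. 3.8] [cite: LottiRomani1983, Thm. 2] [cite: HuangPan1998, (2.8)] -/
theorem polySaturation_iff_powerModulus :
    PolySaturation ↔ ∃ α B : ℝ, 0 < α ∧ α < 1 ∧ 0 < B ∧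
      ∀ F : SpectralMap ℂ, IsUniversalSpectralPoint ℂ F →
        specMMPoint ℂ F 0 + specMMPoint ℂ F 1 + specMMPoint ℂ F 2 - 2 ≤
          B * specMMPoint ℂ F 1 ^ (1 - α) * (1 - specMMPoint ℂ F 2) ^ α := by
  rw [polySaturation_iff_roof]
  constructor
  · rintro ⟨C, k, h⟩
    -- raise the constant to `max C 1` and the degree to `k + 1`
    set C' : ℝ := max C 1 with hC'
    have hC'0 : 0 < C' := lt_of_lt_of_le one_pos (le_max_right _ _)
    have h' : ∀ t : ℝ, 0 ≤ t → t < 1 → ∀ F : SpectralMap ℂ, IsUniversalSpectralPoint ℂ F →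
        t * specMMPoint ℂ F 1 ≤ (1 - specMMPoint ℂ F 0) + C' * ((1 - t)⁻¹) ^ (k + 1) * (1 - specMMPoint ℂ F 2) := by
      intro t ht0 ht1 F hF
      have hε : 0 ≤ 1 - specMMPoint ℂ F 2 := sub_nonneg.2 (AlmanLi2026.prop42_mem_Icc hF 2).2
      have hu : 1 ≤ (1 - t)⁻¹ := (one_le_inv₀ (by linarith)).2 (by linarith)
      have hpow : ((1 - t)⁻¹) ^ k ≤ ((1 - t)⁻¹) ^ (k + 1) := pow_le_pow_right₀ hu (Nat.le_succ k)
      have hRR : C * ((1 - t)⁻¹) ^ k ≤ C' * ((1 - t)⁻¹) ^ (k + 1) := by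
        calc C * ((1 - t)⁻¹) ^ k ≤ C' * ((1 - t)⁻¹) ^ k :=
              mul_le_mul_of_nonneg_right (le_max_left _ _) (by positivity)
          _ ≤ C' * ((1 - t)⁻¹) ^ (k + 1) := mul_le_mul_of_nonneg_left hpow hC'0.le
      have := h t ht0 ht1 F hF
      nlinarith [mul_le_mul_of_nonneg_right hRR hε]
    set α : ℝ := 1 / (((k + 1 : ℕ) : ℝ) + 1) with hα
    have hk1 : (0 : ℝ) < ((k + 1 : ℕ) : ℝ) + 1 := by positivity
    have hα0 : 0 < α := by positivity
    have hα1 : α < 1 := by rw [hα, div_lt_one hk1]; push_cast; linarith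
    refine ⟨α, 2 * C' ^ α, hα0, hα1, by positivity, fun F hF => ?_⟩
    have hmain := powerModulus_of_polyRoof (K := ℂ) hC'0 h' hF
    have e1 : (((k + 1 : ℕ) : ℝ)) / (((k + 1 : ℕ) : ℝ) + 1) = 1 - α := by
      rw [hα]
      field_simp
      ring
    rw [e1, ← hα] at hmain
    linarith
  · rintro ⟨α, B, hα, hα1, hB, h⟩
    exact ⟨B * B ^ ((1 - α) / α) + 1, ⌈(1 - α) / α⌉₊, fun t ht0 ht1 F hF =>
      polyRoof_of_powerModulus hB hα hα1 h ht0 ht1 hF⟩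

/-! ## §2 The power modulus between the corner modulus and the face modulus -/

/-- ★ **Power modulus ⟹ Hölder face law with the same exponent** (every field; `θ₁^{1−α} ≤ 1`).
[cite: AlmanLi2026, Proposition 4.2] -/
theorem holderFace_of_powerModulus {B α : ℝ} (hB : 0 < B) (hα1 : α < 1)
    (h : ∀ F : SpectralMap K, IsUniversalSpectralPoint K F →
      specMMPoint K F 0 + specMMPoint K F 1 + specMMPoint K F 2 - 2 ≤
        B * specMMPoint K F 1 ^ (1 - α) * (1 - specMMPoint K F 2) ^ α)
    {F : SpectralMap K} (hF : IsUniversalSpectralPoint K F) :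
    specMMPoint K F 0 + specMMPoint K F 1 + specMMPoint K F 2 - 2 ≤ B * (1 - specMMPoint K F 2) ^ α := by
  have h1 := AlmanLi2026.prop42_mem_Icc hF 1
  have h2 := AlmanLi2026.prop42_mem_Icc hF 2
  have hθ : specMMPoint K F 1 ^ (1 - α) ≤ 1 := Real.rpow_le_one h1.1 h1.2 (by linarith)
  have hε : 0 ≤ (1 - specMMPoint K F 2) ^ α := Real.rpow_nonneg (sub_nonneg.2 h2.2) _
  have := h F hF
  have : B * specMMPoint K F 1 ^ (1 - α) * (1 - specMMPoint K F 2) ^ α ≤ B * 1 * (1 - specMMPoint K F 2) ^ α :=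
    mul_le_mul_of_nonneg_right (mul_le_mul_of_nonneg_left hθ hB.le) hε
  linarith

/-- ★★ **Power modulus ⟹ corner (logarithmic) modulus at EVERY scale `κ > 0`, with threshold `u₀ = 2B/(α²κ)`**
(every field): under `d ≤ B·θ₁^{1−α}·ε₂^α` (`B, α > 0`), every universal spectral point off the face with
`u = log(θ₁/ε₂) ≥ 2B/(α²κ)` satisfies `d·u ≤ κ·θ₁` — since `ε₂ = θ₁e^{−u}` gives `d ≤ Bθ₁e^{−αu}` and
`u·e^{−αu} ≤ 2/(α²u) ≤ κ/B`.  So a power modulus of ANY exponent forces the corner modulus `κ*` to vanish.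
[cite: Strassen1988, Thm. 3.8] [cite: CoppersmithWinograd1990, §8] -/
theorem logModulus_of_powerModulus {B α : ℝ} (hB : 0 < B) (hα : 0 < α)
    (h : ∀ F : SpectralMap K, IsUniversalSpectralPoint K F →
      specMMPoint K F 0 + specMMPoint K F 1 + specMMPoint K F 2 - 2 ≤
        B * specMMPoint K F 1 ^ (1 - α) * (1 - specMMPoint K F 2) ^ α)
    {κ : ℝ} (hκ : 0 < κ) {F : SpectralMap K} (hF : IsUniversalSpectralPoint K F) (hoff : specMMPoint K F 2 < 1)
    (hu : 2 * B / (α ^ 2 * κ) ≤ Real.log (specMMPoint K F 1 / (1 - specMMPoint K F 2))) :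
    (specMMPoint K F 0 + specMMPoint K F 1 + specMMPoint K F 2 - 2) *
        Real.log (specMMPoint K F 1 / (1 - specMMPoint K F 2)) ≤ κ * specMMPoint K F 1 := by
  set θ₀ := specMMPoint K F 0 with hθ₀
  set θ₁ := specMMPoint K F 1 with hθ₁
  set θ₂ := specMMPoint K F 2 with hθ₂
  have h1 := AlmanLi2026.prop42_mem_Icc hF 1
  rw [← hθ₁] at h1
  have hd := h F hF
  rw [← hθ₀, ← hθ₁, ← hθ₂] at hd
  have hε0 : 0 < 1 - θ₂ := by linarith
  set u : ℝ := Real.log (θ₁ / (1 - θ₂)) with hudef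
  have hu0' : 0 < 2 * B / (α ^ 2 * κ) := by positivity
  have hu0 : 0 < u := lt_of_lt_of_le hu0' hu
  rcases h1.1.eq_or_lt with h10 | hθ1
  · -- `θ₁ = 0`: `u = log 0 = 0`, contradiction with `u > 0`
    exfalso
    rw [hudef, ← h10, zero_div, Real.log_zero] at hu0
    exact lt_irrefl _ hu0
  -- `ε₂ = θ₁ e^{-u}`
  have hexp : Real.exp u = θ₁ / (1 - θ₂) := by rw [hudef, Real.exp_log (div_pos hθ1 hε0)]
  have hεu : 1 - θ₂ = θ₁ / Real.exp u := by
    rw [hexp, div_div_eq_mul_div, mul_div_cancel_left₀ _ hθ1.ne']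
  -- the law becomes `d ≤ B θ₁ / e^{αu}`
  have hεα : (1 - θ₂) ^ α = θ₁ ^ α / Real.exp (α * u) := by
    rw [hεu, Real.div_rpow hθ1.le (Real.exp_pos u).le, mul_comm α u, Real.exp_mul]
  have hsplit : θ₁ ^ (1 - α) * θ₁ ^ α = θ₁ := by
    rw [← Real.rpow_add hθ1, sub_add_cancel, Real.rpow_one]
  have hEpos : 0 < Real.exp (α * u) := Real.exp_pos _
  have hd' : θ₀ + θ₁ + θ₂ - 2 ≤ B * θ₁ / Real.exp (α * u) := by
    rw [hεα, ← mul_div_assoc, mul_assoc, hsplit] at hd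
    exact hd
  -- `u / e^{αu} ≤ 2/(α² u) ≤ κ / B`
  have hpow : (α * u) ^ 2 / 2 ≤ Real.exp (α * u) := by
    have := Real.pow_div_factorial_le_exp (x := α * u) (hx := by positivity) (n := 2)
    simpa [Nat.factorial] using this
  have hux : u / Real.exp (α * u) ≤ 2 / (α ^ 2 * u) := by
    rw [div_le_div_iff₀ hEpos (by positivity)]
    nlinarith
  have huB : 2 / (α ^ 2 * u) ≤ κ / B := by
    rw [div_le_div_iff₀ (by positivity) hB]
    have := (div_le_iff₀ (by positivity : (0 : ℝ) < α ^ 2 * κ)).1 hu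
    nlinarith
  -- assemble: `d u ≤ (Bθ₁/e^{αu}) u = Bθ₁ (u/e^{αu}) ≤ Bθ₁ κ/B = κ θ₁`
  have hdu : (θ₀ + θ₁ + θ₂ - 2) * u ≤ B * θ₁ / Real.exp (α * u) * u :=
    mul_le_mul_of_nonneg_right hd' hu0.le
  have hR : B * θ₁ / Real.exp (α * u) * u = B * θ₁ * (u / Real.exp (α * u)) := by ring
  have hfin : B * θ₁ * (u / Real.exp (α * u)) ≤ B * θ₁ * (κ / B) :=
    mul_le_mul_of_nonneg_left (hux.trans huB) (by positivity)
  have hκB : B * θ₁ * (κ / B) = κ * θ₁ := by field_simp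
  linarith [hdu, hR.le, hfin, hκB.le]

/-- ★★ **`PolySaturation ⟹ SubexpSaturation`, read off the moduli** (over `ℂ`): a power modulus (§1) gives the
corner modulus law at every `κ > 0` (§2), which is the deciding crux by file 3's `subexpSaturation_iff_modulus`.
(The implication itself is elementary — every polynomial is subexponential — the point is the modulus route.)
[cite: Strassen1988, Thm. 3.8] [cite: AlmanDuanVassilevskaWilliamsXuXuZhou2025, §3.4] -/
theorem subexpSaturation_of_powerModulus {B α : ℝ} (hB : 0 < B) (hα : 0 < α)
    (h : ∀ F : SpectralMap ℂ, IsUniversalSpectralPoint ℂ F →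
      specMMPoint ℂ F 0 + specMMPoint ℂ F 1 + specMMPoint ℂ F 2 - 2 ≤
        B * specMMPoint ℂ F 1 ^ (1 - α) * (1 - specMMPoint ℂ F 2) ^ α) :
    SubexpSaturation := by
  rw [subexpSaturation_iff_modulus]
  intro κ hκ
  exact ⟨2 * B / (α ^ 2 * κ), fun F hF hoff hu => logModulus_of_powerModulus hB hα h hκ hF hoff hu⟩

/-- ★ **`PolySaturation ⟹` a power rate with the dual exponent**, read off the moduli (every field): the power
modulus of exponent `α` gives the Hölder face law of exponent `α` (§2) and hence
`ω(1,k,1) − (k+1) ≤ 2^β(B + B·B^β)·k^{−β}`, `β = α/(1−α)`, for every real `k ≥ 1` (file 4).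
[cite: LottiRomani1983, §1] [cite: HuangPan1998, (2.8)] -/
theorem farRate_of_powerModulus {B α : ℝ} (hB : 0 < B) (hα : 0 < α) (hα1 : α < 1)
    (h : ∀ F : SpectralMap K, IsUniversalSpectralPoint K F →
      specMMPoint K F 0 + specMMPoint K F 1 + specMMPoint K F 2 - 2 ≤
        B * specMMPoint K F 1 ^ (1 - α) * (1 - specMMPoint K F 2) ^ α)
    {k : ℝ} (hk : 1 ≤ k) :
    omegaRect K 1 k 1 - (k + 1) ≤ 2 ^ (α / (1 - α)) * (B + B * B ^ (α / (1 - α))) * k ^ (-(α / (1 - α))) :=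
  farRate_of_holderFace hB hα hα1 (fun _ hF => holderFace_of_powerModulus hB hα1 h hF) hk

end Summit.MatrixMultiplication.MatrixMultiplication.Theorems.SaturationLadderPowerModulus

end
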